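import Summits.PneNP.PneNP.Theorems.LatticeMagicTargetStubBridgeVerifier
import Summits.PneNP.PneNP.Theorems.LatticeMagicTargetSqueezeVacuity

/-!
# `stub_bridge`, part 5/6: the proof system of the bridge and the game student `S' ∈ FP`

Line `SketchIdeator5` of crux `Target` (stmt-PneNP-10709), stub `stub_bridge` (Krajíček,
arXiv:2506.20221 §2, the Student–Teacher simulation). Contents:

* `bridgeF Fc = Fc ∘ paramNormF` and **`isProofSystemFor_bridge`**: `bridgeV V₀ (bridgeF Fc)` is a
  Cook–Reckhow proof system for `TAUT` (soundness of the new branch = `isTautology_genForm`);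
* the game student built from a `DD_V`-student `S ∈ FP`: it answers a constant in round `0`, learns
  `n = |u|` from the first reveal, regenerates the `DD_V`-instance (`piStr`, `codesStr`,
  `ddViewStr`), replays `S` along the later reveals — each reveal `(j, u)` becoming the `DD_V`-history
  entry `(i, stretch t (0 · wit ⟨⟨1ⁿ, ⟨w_j, [v_j]⟩⟩, u⟩))` (`ansOf`, `replay`) — and proposes the bit
  vector of the index `S` answers next (`studentFn`); all of it polynomial time on codes by the
  `CodeFP` combinators (`codeFP_replay` by induction on the constant fuel, **`exists_student`**);
* the views as codes (`hbView_eq`, `ddView_eq`, with `SqueezeVacuity.flat_eq_encList`) and the replay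
  lemmas (`replay_append_singleton`).

## References

* J. Krajíček, *A proof complexity conjecture and the Incompleteness theorem*, arXiv:2506.20221, §2
  (`DD_P`, Hypothesis (ST)); J. Krajíček, LMCS 16 (3:9) 2020.
* S. Arora, B. Barak, *Computational Complexity: A Modern Approach*, CUP 2009, §0.1 (codes), §1.3
  (closure of polynomial time), §2.3 (CNFs, Cook–Levin), Example 2.21.
* S. A. Cook, R. A. Reckhow, JSL 44 (1979), §1 (proof systems).
-/

set_option linter.dupNamespace false -- summit = sub-problem (D-0017)

namespace Summit.PneNP.PneNP.Theorems.LatticeMagicTarget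

open Literature.Computability.Complexity
open Literature.Computability.MetaComplexity
open _root_.Computability

namespace StubBridge

section ProofSystem

open Brick Plumb CodeFP

/-! #### The generator as a string function -/

variable {Φ : List Bool → CNF ℕ} {g : List Bool → List Bool} {B : List Bool → Bool}

/-- The generator on all strings: normalise, then run the code-level generator `Fc`. -/
noncomputable def bridgeF (Fc : List Bool → List Bool) : List Bool → List Bool := Fc ∘ paramNormF

/-- `bridgeF Fc ∈ FP` for `Fc ∈ FP`. -/
theorem bridgeF_mem_FP {Fc : List Bool → List Bool} (hFc : Fc ∈ FP) : bridgeF Fc ∈ FP := comp_mem_FP hFc paramNormF_mem_FP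

/-- On a parameter code the generator produces the code of the generated formula. -/
theorem bridgeF_paramE {Fc : List Bool → List Bool} (hFcG : ∀ a, Fc (paramE a) = encE (genForm Φ a)) (a : Param) :
    bridgeF Fc (paramE a) = encE (genForm Φ a) := by
  rw [bridgeF, Function.comp_apply, paramNormF_paramE, hFcG]

/-- **Every value of the generator is the code of a tautology.** -/
theorem bridgeF_mem_TAUT {Fc : List Bool → List Bool} (hFcG : ∀ a, Fc (paramE a) = encE (genForm Φ a))
    (hΦ : ∀ (N w : List Bool) (b : Bool),
      (Φ (xin N w b)).Satisfiable ↔ ∃ u : List Bool, u.length = N.length ∧ g u = w ∧ B u ≠ b)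
    (hinj : InjOnLengths g) (r : List Bool) : bridgeF Fc r ∈ TAUT := by
  rw [bridgeF, Function.comp_apply, paramNormF_eq_paramE, hFcG]
  exact (mem_TAUT_iff _).2 (isTautology_genForm g B hΦ hinj _)

/-- **The proof system of the bridge**: `bridgeV V₀ (bridgeF Fc)` is a Cook–Reckhow proof system for
`TAUT`. -/
theorem isProofSystemFor_bridge {V₀ : List Bool → List Bool → Bool} (hV₀ : IsProofSystemFor V₀ TAUT)
    {Fc : List Bool → List Bool} (hFc : Fc ∈ FP) (hFcG : ∀ a, Fc (paramE a) = encE (genForm Φ a))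
    (hΦ : ∀ (N w : List Bool) (b : Bool),
      (Φ (xin N w b)).Satisfiable ↔ ∃ u : List Bool, u.length = N.length ∧ g u = w ∧ B u ≠ b)
    (hinj : InjOnLengths g) : IsProofSystemFor (bridgeV V₀ (bridgeF Fc)) TAUT :=
  isProofSystemFor_bridgeV hV₀ (bridgeF_mem_FP hFc) (bridgeF_mem_TAUT hFcG hΦ hinj)

end ProofSystem

/-! ## Part 5: the game student built from a `DD`-student (`S' ∈ FP`) -/

section Student

open Brick Plumb CodeFP

/-- History entries `(index, string)` — of the game (`(j, u_j)`) and of `DD_V` (`(i, assignment)`). -/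
abbrev Entry : Type := ℕ × List Bool

/-- Entries are coded `⟨1^index, string⟩` (as in `hbView` / `ddView`). -/
abbrev entE : Entry → List Bool := pairE unE strE

/-- The regenerated context of a play: `(N, w⃗) = (1ⁿ, images)`. -/
abbrev Ctx : Type := List Bool × List (List Bool)

/-- Contexts are coded `⟨N, encList w⃗⟩`. -/
abbrev ctxE : Ctx → List Bool := pairE strE (rawE strE)

variable (Φ : List Bool → CNF ℕ) (wit S : List Bool → List Bool) (t K : ℕ)

/-- The generator's parameter of a context: pad length `2^t - 1` (so the guard holds with equality). -/
def paramOf (c : Ctx) : Param := (c.1, c.2, 2 ^ t - 1)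

/-- The `DD_V`-instance's proof string: `1 · ⟨N, ⟨encList w⃗, 1^{2^t - 1}⟩⟩`. -/
def piStr (c : Ctx) : List Bool := true :: paramE (paramOf t c)

/-- The coded list of the instance's disjuncts. -/
def codesStr (c : Ctx) : List Bool := rawE encE (disjuncts Φ (paramOf t c))

/-- The `DD_V` view the simulated student `S` is shown: instance and history so far. -/
def ddViewStr (c : Ctx) (H : List Entry) : List Bool :=
  boolPair (boolPair (piStr t c) (codesStr Φ t c)) (rawE entE H)

/-- The index `S` proposes on that view (its answer read in unary, i.e. its length). -/
def idxOf (c : Ctx) (H : List Entry) : ℕ := (S (ddViewStr Φ t c H)).length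

/-- The bit vector of an index (junk `ε` out of range). -/
def vecOf (i : ℕ) : List Bool := (allVecs t).getD i []

/-- The assignment answering a proposal `i` when the game reveals `(j, u)`: the Levin witness of the
instance `⟨N, ⟨w_j, [v_j]⟩⟩` paired with `u`, shifted behind a leading `0` and stretched `2^t`-fold
(the transport to the tagged variables, `getD_stretch_tagVar`). -/
def ansOf (c : Ctx) (e : Entry) (i : ℕ) : List Bool :=
  stretch t (false :: wit (boolPair (xin c.1 (c.2.getD e.1 []) ((vecOf t i).getD e.1 false)) e.2))

/-- Replaying `S` along the game's reveals (fuel, context, remaining reveals, `DD`-history so far). -/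
def replay : ℕ → Ctx → List Entry → List Entry → List Entry
  | 0, _, _, H => H
  | _ + 1, _, [], H => H
  | f + 1, c, e :: rest, H => replay f c rest (H ++ [(idxOf Φ S t c H, ansOf wit t c e (idxOf Φ S t c H))])

/-- **The game student** on a decoded view `(w⃗, h)`: a constant in round `0`; afterwards it learns
`n = |u|` from the first reveal, replays `S` for the later reveals (at most `K` of them) and proposes
the bit vector of the index `S` answers next. -/
def studentFn (ws : List (List Bool)) : List Entry → List Bool
  | [] => []
  | e₀ :: rest =>
    vecOf t (idxOf Φ S t (unE e₀.2.length, ws) (replay Φ wit S t K (unE e₀.2.length, ws) rest []))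

variable {Φ wit S} {gen : List Bool → List Bool}

/-- The parameter of a context, on codes. -/
theorem codeFP_paramOf : CodeFP ctxE paramE (paramOf t) :=
  (fst _ _).pair ((snd _ _).pair (const ctxE (2 ^ t - 1)))

/-- The proof string, on codes. -/
theorem codeFP_piStr : CodeFP ctxE strE (piStr t) :=
  (codeFP_cons true).comp ((codeFP_paramOf t).recodeOut (eγ := strE) fun _ => rfl)

/-- The coded disjuncts, on codes. -/
theorem codeFP_codesStr (hgen : gen ∈ FP) (hgenΦ : ∀ x, gen x = encodingCNF.encode (Φ x)) :
    CodeFP ctxE strE (codesStr Φ t) :=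
  ((codeFP_disjuncts hgen hgenΦ).comp (codeFP_paramOf t)).recodeOut (eγ := strE) fun _ => rfl

/-- The `DD_V` view, on codes. -/
theorem codeFP_ddViewStr (hgen : gen ∈ FP) (hgenΦ : ∀ x, gen x = encodingCNF.encode (Φ x)) :
    CodeFP (pairE ctxE (rawE entE)) strE fun p => ddViewStr Φ t p.1 p.2 :=
  ((((codeFP_piStr t).pair (codeFP_codesStr t hgen hgenΦ)).comp (fst _ _)).pair (snd _ _)).recodeOut
    (eγ := strE) fun _ => rfl

/-- The proposed index, on codes (in unary). -/
theorem codeFP_idxOf (hS : S ∈ FP) (hgen : gen ∈ FP) (hgenΦ : ∀ x, gen x = encodingCNF.encode (Φ x)) :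
    CodeFP (pairE ctxE (rawE entE)) unE fun p => idxOf Φ S t p.1 p.2 :=
  strLength.comp ((of_fn (eα := strE) (eβ := strE) (g := S) S hS fun _ => rfl).comp (codeFP_ddViewStr t hgen hgenΦ))

/-- The bit vector of an index, on codes. -/
theorem codeFP_vecOf : CodeFP unE strE (vecOf t) :=
  ((rawGetD strE (d := ([] : List Bool)) rfl).comp ((const unE (allVecs t)).pair natOfUn)).congr fun _ => rfl

/-- The answer assignment, on codes. -/
theorem codeFP_ansOf (hwit : wit ∈ FP) : CodeFP (pairE ctxE (pairE entE unE)) strE fun p => ansOf wit t p.1 p.2.1 p.2.2 := by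
  have hw : CodeFP (pairE ctxE (pairE entE unE)) strE fun p => p.1.2.getD p.2.1.1 [] :=
    (rawGetD strE (d := ([] : List Bool)) rfl).comp ((fst _ _).snd'.pair (natOfUn.comp (snd _ _).fst'.fst'))
  have hb : CodeFP (pairE ctxE (pairE entE unE)) bitE fun p => (vecOf t p.2.2).getD p.2.1.1 false :=
    codeFP_getBit.comp ((snd _ _).fst'.fst'.pair ((codeFP_vecOf t).comp (snd _ _).snd'))
  have hx : CodeFP (pairE ctxE (pairE entE unE)) strE fun p => xin p.1.1 (p.1.2.getD p.2.1.1 []) ((vecOf t p.2.2).getD p.2.1.1 false) :=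
    codeFP_xin.comp ((fst _ _).fst'.pair (hw.pair hb))
  have hp : CodeFP (pairE ctxE (pairE entE unE)) strE fun p =>
      boolPair (xin p.1.1 (p.1.2.getD p.2.1.1 []) ((vecOf t p.2.2).getD p.2.1.1 false)) p.2.1.2 :=
    (hx.pair (snd _ _).fst'.snd').recodeOut (eγ := strE) fun _ => rfl
  exact ((codeFP_stretch t).comp ((codeFP_cons false).comp ((of_fn (eα := strE) (eβ := strE) (g := wit) wit hwit
    fun _ => rfl).comp hp))).congr fun _ => rfl

/-- **The replay, on codes** (by induction on the fuel: each level is a case analysis on the reveals). -/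
theorem codeFP_replay (hS : S ∈ FP) (hwit : wit ∈ FP) (hgen : gen ∈ FP) (hgenΦ : ∀ x, gen x = encodingCNF.encode (Φ x)) :
    ∀ f : ℕ, CodeFP (pairE ctxE (pairE (rawE entE) (rawE entE))) (rawE entE) fun p => replay Φ wit S t f p.1 p.2.1 p.2.2
  | 0 => ((snd _ _).snd').congr fun _ => rfl
  | f + 1 => by
    -- context `(c, H)`, list `rest`
    let σE : Ctx × List Entry → List Bool := pairE ctxE (rawE entE)
    have hidx : CodeFP σE unE fun s => idxOf Φ S t s.1 s.2 := codeFP_idxOf t hS hgen hgenΦ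
    have hnew : CodeFP (pairE σE (pairE entE (rawE entE))) (rawE entE) fun q =>
        q.1.2 ++ [(idxOf Φ S t q.1.1 q.1.2, ansOf wit t q.1.1 q.2.1 (idxOf Φ S t q.1.1 q.1.2))] :=
      (rawAppend entE).comp ((fst _ _).snd'.pair ((rawSingleton entE).comp ((hidx.comp (fst _ _)).pair
        ((codeFP_ansOf t hwit).comp ((fst _ _).fst'.pair ((snd _ _).fst'.pair (hidx.comp (fst _ _))))))))
    have hcons : CodeFP (pairE σE (pairE entE (rawE entE))) (rawE entE) fun q =>
        replay Φ wit S t f q.1.1 q.2.2 (q.1.2 ++ [(idxOf Φ S t q.1.1 q.1.2, ansOf wit t q.1.1 q.2.1 (idxOf Φ S t q.1.1 q.1.2))]) :=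
      (codeFP_replay hS hwit hgen hgenΦ f).comp ((fst _ _).fst'.pair ((snd _ _).snd'.pair hnew))
    have hc := rawCases (σ := Ctx × List Entry) (eσ := σE) (eα := entE)
      (k := fun s rest => replay Φ wit S t (f + 1) s.1 rest s.2) (gnil := fun s => s.2)
      (gcons := fun q => replay Φ wit S t f q.1.1 q.2.2
        (q.1.2 ++ [(idxOf Φ S t q.1.1 q.1.2, ansOf wit t q.1.1 q.2.1 (idxOf Φ S t q.1.1 q.1.2))]))
      (snd _ _) hcons (fun _ => rfl) (fun _ _ _ => rfl)
    exact (hc.comp (((fst _ _).pair (snd _ _).snd').pair (snd _ _).fst')).congr fun _ => rfl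

/-- **The game student, on codes.** -/
theorem codeFP_studentFn (hS : S ∈ FP) (hwit : wit ∈ FP) (hgen : gen ∈ FP) (hgenΦ : ∀ x, gen x = encodingCNF.encode (Φ x)) :
    CodeFP (pairE (rawE strE) (rawE entE)) strE fun p => studentFn Φ wit S t K p.1 p.2 := by
  -- context `ws`, list `h`; cons case `(ws, e₀, rest)`
  let τE : List (List Bool) × Entry × List Entry → List Bool := pairE (rawE strE) (pairE entE (rawE entE))
  have hN : CodeFP τE strE fun q => (unE q.2.1.2.length : List Bool) :=
    (strLength.comp (snd _ _).fst'.snd').recodeOut (eγ := strE) fun _ => rfl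
  have hctx : CodeFP τE ctxE fun q => ((unE q.2.1.2.length : List Bool), q.1) := hN.pair (fst _ _)
  have hrep : CodeFP τE (rawE entE) fun q => replay Φ wit S t K (unE q.2.1.2.length, q.1) q.2.2 [] :=
    (codeFP_replay t hS hwit hgen hgenΦ K).comp (hctx.pair ((snd _ _).snd'.pair (const τE ([] : List Entry))))
  -- (elaborated without expected type: the combinator shape is matched first-order afterwards)
  have hidx := (codeFP_idxOf t hS hgen hgenΦ).comp (hctx.pair hrep)
  have hcons := (codeFP_vecOf t).comp hidx
  have hc := rawCases (σ := List (List Bool)) (eσ := rawE strE) (eα := entE)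
    (k := fun ws h => studentFn Φ wit S t K ws h) (gnil := fun _ => ([] : List Bool))
    (const _ _) hcons (fun _ => rfl) (fun _ _ _ => rfl)
  exact hc

/-- **The game student is a polynomial-time string function** agreeing with `studentFn` on views. -/
theorem exists_student (hS : S ∈ FP) (hwit : wit ∈ FP) (hgen : gen ∈ FP) (hgenΦ : ∀ x, gen x = encodingCNF.encode (Φ x)) :
    ∃ S' : List Bool → List Bool, S' ∈ FP ∧ ∀ (ws : List (List Bool)) (h : List Entry),
      S' (pairE (rawE strE) (rawE entE) (ws, h)) = studentFn Φ wit S t K ws h := by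
  obtain ⟨S', hS', h⟩ := codeFP_studentFn t K hS hwit hgen hgenΦ
  exact ⟨S', hS', fun ws hh => h (ws, hh)⟩

end Student

/-! ## Part 6: the lock-step simulation and Hypothesis (ST) -/

section Simulation

open Brick CodeFP

variable {t : ℕ}

/-- **The game view is the code of `(images, history)`.** -/
theorem hbView_eq (g : List Bool → List Bool) (I : HBInstance t) (hist : List Entry) :
    hbView g I hist = pairE (rawE strE) (rawE entE) (imgs g I, hist) := by
  simp only [hbView, imgs, SqueezeVacuity.flat_eq_encList, pairE_apply, rawE, strE, List.map_id]
  rfl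

variable {V : List Bool → List Bool → Bool} (Φ : List Bool → CNF ℕ) (wit S : List Bool → List Bool) (K : ℕ)

/-- **The `DD_V` view is `ddViewStr`** for an instance with the generated disjuncts and proof string. -/
theorem ddView_eq {c : Ctx} (I : DDInstance V) (hl : I.l = disjuncts Φ (paramOf t c)) (hπ : I.π = piStr t c)
    (H : List Entry) : ddView I H = ddViewStr Φ t c H := by
  simp only [ddView, hl, hπ, SqueezeVacuity.flat_eq_encList, ddViewStr, codesStr, rawE]
  rfl

/-- Length of a `DD_V` history. -/
theorem length_ddHist (T : DDTeacher) (I : DDInstance V) : ∀ m, (ddHist S T I m).length = m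
  | 0 => rfl
  | m + 1 => by
    show (ddHist S T I m ++ _).length = m + 1
    rw [List.length_append, length_ddHist T I m]; rfl

/-- The proposal of a round is the index `S` answers on `ddViewStr`. -/
theorem ddProposal_eq {c : Ctx} (T : DDTeacher) (I : DDInstance V) (hl : I.l = disjuncts Φ (paramOf t c))
    (hπ : I.π = piStr t c) (m : ℕ) : ddProposal S T I m = idxOf Φ S t c (ddHist S T I m) := by
  rw [ddProposal, ddView_eq Φ I hl hπ]; rfl

/-- Replaying no reveal. -/
theorem replay_nil (c : Ctx) (H : List Entry) : ∀ f, replay Φ wit S t f c [] H = H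
  | 0 => rfl
  | _ + 1 => rfl

/-- **Replaying one more reveal** (with enough fuel): one more `DD_V` round is appended. -/
theorem replay_append_singleton (c : Ctx) (e : Entry) :
    ∀ (L : List Entry) (f : ℕ) (H : List Entry), L.length < f →
      replay Φ wit S t f c (L ++ [e]) H =
        replay Φ wit S t f c L H ++ [(idxOf Φ S t c (replay Φ wit S t f c L H),
          ansOf wit t c e (idxOf Φ S t c (replay Φ wit S t f c L H)))]
  | [], f + 1, H, _ => by
    rw [List.nil_append, replay_nil]
    show replay Φ wit S t f c [] _ = _
    rw [replay_nil]
  | e' :: L, f + 1, H, hf => by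
    rw [List.cons_append]
    show replay Φ wit S t f c (L ++ [e]) _ = replay Φ wit S t f c L _ ++ _
    exact replay_append_singleton c e L f _ (by simpa using hf)

end Simulation

end StubBridge

/-- **The game student is polynomial time** (explicit-binder form, registered sub-goal
`stubBridge_exists_student` of stmt-PneNP-10709; chain `stub_bridge` 5/6). -/
theorem stubBridge_exists_student (Φ : List Bool → CNF ℕ) (wit S gen : List Bool → List Bool) (t K : ℕ)
    (hS : S ∈ FP) (hwit : wit ∈ FP) (hgen : gen ∈ FP) (hgenΦ : ∀ x, gen x = encodingCNF.encode (Φ x)) :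
    ∃ S' : List Bool → List Bool, S' ∈ FP ∧ ∀ (ws : List (List Bool)) (h : List StubBridge.Entry),
      S' (CodeFP.pairE (CodeFP.rawE CodeFP.strE) (CodeFP.rawE StubBridge.entE) (ws, h)) =
        StubBridge.studentFn Φ wit S t K ws h :=
  StubBridge.exists_student t K hS hwit hgen hgenΦ

end Summit.PneNP.PneNP.Theorems.LatticeMagicTarget
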